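/-
Copyright: the b2b-balaban T⁴-continuum CRUX team, row NE7b OWNER lineage `t4-ne7b-p1` (gen 136). Project licence.
-/
import Summits.QuantumFields.BalabanUV.T4Continuum.Spine.NE7b.SupNextPotentialCubicTaylor

/-!
# THE POST-EXTRACTION FORMAT ON THE LINE — (α4)'s ENTRY, ROAD READING OF (384): the cubic Taylor letter of (338) is HOMOGENEOUS OF DEGREE
# THREE in the direction `h`, so by Cauchy–Schwarz on the sites `Y` (`Σ|h| ≤ √#Y·√Q`, `Σ|h|³ ≤ √Q·Q`, `Q = Σ_Y h²`) it IS the cubic letter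
# `|r(h)| ≤ C₃·√Q(h)·Q(h)` of (384), with the EXPLICIT constant
#   `6C₃ = (κ₁³#Y²L₃ + 3κ₂κ₁√#Y·L₁ + κ₃) + 3κ₁√#Y·L₁(κ₁²#Y·L₂ + κ₂) + 2(κ₁√#Y·L₁)³`
# for the Taylor remainder `r(h) = log Z(ψ₀+h) − log Z(ψ₀) − (log Z)′(0) − ½(log Z)″(0)` of the next potential along `ψ₀ + t·h`; hence THE
# FACTORISATION `Z(ψ₀+h) = Z(ψ₀)·e^{(log Z)′(0) + ½(log Z)″(0)}·e^{r(h)}` (extracted constant × extracted Gaussian part × residual factor) with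
# the residual factor's two letters on the ball `Q(h) ≤ H²`: smallness `|e^{r(h)} − 1| ≤ 2C₃H³` (when `C₃H³ ≤ 1`) and stability `e^{r(h)} ≤ e^{C₃H·Q(h)}`
# — RATE PROPORTIONAL TO THE RADIUS (row NE7b, node U5c; (337b)∕(338) BY NAME; [folklore])

Cell `pub-balaban`, sub-cell `t4`, spine estimate NE7b (`T4WeightBudget.RelWeightBound`; the cell's OWN estimate — NOT PRINTED in
[Bałaban 1983–89], NOT PROVED).  Crux-route work under `Spine/NE7b/` by the row OWNER (`t4-ne7b-p1` gen 136, file (386)) under FREEZE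
(0)'s crux-prover clause, on gen 135's SCOPING-d7 DECISION (d7′)(2′)(ii) («the road reading of (384) with (338)'s `C₃`»); NOTHING of
Bałaban's is named as a Lean object, valued or asserted; no `T4Continuum/Support` leaf typed; no `def`, no notation; zero `sorry`.
Imports (BY NAME): the OWNER's (338) `…SupNextPotentialCubicTaylor` (`cubic_taylor_line`) and through it (337b) (`lineZ_pos`); Mathlib's
`Finset.sum_mul_sq_le_sq_mul_sq` (Cauchy–Schwarz), `Real.abs_exp_sub_one_le`.

WHAT IS PROVED ([folklore]):
* §1 `sum_abs_le_sqrt_card_mul_sqrt` (`Σ_Y|h| ≤ √#Y·√(Σ_Y h²)`), `abs_le_sqrt_sum_sq` (`|h_x| ≤ √(Σ_Y h²)`), `sum_abs_cube_le` (`Σ_Y|h|³ ≤ √Q·Q`),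
  **`cubic_constant_le`** (the letter `M(h)` of (338) is `≤ 6C₃·√Q·Q` with the explicit `C₃` above);
* §2 `exp_letters_of_cubic` (pure real: `|r| ≤ C₃√Q·Q`, `Q ≤ H²` ⟹ `|r| ≤ C₃HQ`, `|r| ≤ C₃H³`, `e^r ≤ e^{C₃HQ}`, and `|e^r − 1| ≤ 2C₃H³` if
  `C₃H³ ≤ 1`), `factorisation_of_logs` (`Z₁ = Z₀·e^{ℓ+q∕2}·e^{log Z₁ − log Z₀ − ℓ − q∕2}` for `Z₀, Z₁ > 0`);
* §3 THE END on the line: **`cubic_letter_line`** (under (338)'s hypotheses and `0 ≤ L₁, L₂, L₃`: `|r(h)| ≤ C₃·√Q(h)·Q(h)`),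
  **`extraction_format_line`** (the factorisation of `Z(ψ₀+h)` and the residual factor's two letters on the ball `Q(h) ≤ H²`); §4 toy.

HONEST (what this is NOT).  `C₃` is O(1)·#Y^{3∕2} in the tilted-moment letters — NOT small; that `C₃H³` and `C₃H` beat the INPUT letters
in natural units is the d = 4 dimensional analysis (contraction), NOT claimed; the extracted Gaussian part's absorption into the next
covariance is (385) (`SupGaussianQuadraticAbsorption`), its margin along the scales is the dressed column's business; the letters `L_k` are
hypotheses here (discharged on the road by (339) `cubic_taylor_road`); scalar skeleton ((A3), NC-NE7b-α UNRULED); nothing of Bałaban's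
asserted.  BY-NAME EFFECT ON THE WALL: NONE.  NE7b NOT PRINTED ∕ NOT PROVED; spine PROVED 0∕9; rung (B)+1 — the programme's measures remain
FINITE-torus statements; NOT the mass gap, NOT Clay.  HONEST DEPENDENCY: continuum YM on T⁴ ⇐ BetaPertH ∧ nine spine estimates (0∕9
proved); BetaPertH ⇐ (D1) ∧ (D4) ∧ CAP+tail; G-an2-4 gates asym, D1 and NE2∕3∕4.
-/

set_option autoImplicit false

noncomputable section

namespace Summit.QuantumFields.BalabanUV.T4Continuum.NE7b.SupQuadraticExtractionLine

open MeasureTheory ProbabilityTheory Finset Real Set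
open scoped BigOperators
open SupNextPotentialThirdLetter (lineZ_pos)
open SupNextPotentialCubicTaylor (cubic_taylor_line)

/-! ## §1. Cauchy–Schwarz bookkeeping: the cubic Taylor letter is homogeneous of degree three -/

section CS

variable {ι : Type*}

/-- `Σ_Y|h| ≤ √#Y·√(Σ_Y h²)` (Cauchy–Schwarz). [folklore] -/
theorem sum_abs_le_sqrt_card_mul_sqrt (Y : Finset ι) (h : ι → ℝ) :
    ∑ x ∈ Y, |h x| ≤ Real.sqrt Y.card * Real.sqrt (∑ x ∈ Y, h x ^ 2) := by
  have hcs := Finset.sum_mul_sq_le_sq_mul_sq Y (fun x => |h x|) (fun _ => (1 : ℝ))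
  simp only [mul_one, one_pow, sum_const, nsmul_eq_mul, sq_abs] at hcs
  have h0 : 0 ≤ ∑ x ∈ Y, |h x| := sum_nonneg fun x _ => abs_nonneg _
  rw [← Real.sqrt_mul (Nat.cast_nonneg _), ← Real.sqrt_sq h0]
  exact Real.sqrt_le_sqrt (by linarith)

/-- `x ∈ Y ⟹ |h_x| ≤ √(Σ_Y h²)`. [folklore] -/
theorem abs_le_sqrt_sum_sq (Y : Finset ι) (h : ι → ℝ) {x : ι} (hx : x ∈ Y) : |h x| ≤ Real.sqrt (∑ y ∈ Y, h y ^ 2) := by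
  rw [← Real.sqrt_sq (abs_nonneg (h x)), sq_abs]
  exact Real.sqrt_le_sqrt (single_le_sum (fun y _ => sq_nonneg (h y)) hx)

/-- `Σ_Y|h|³ ≤ √(Σ_Y h²)·Σ_Y h²`. [folklore] -/
theorem sum_abs_cube_le (Y : Finset ι) (h : ι → ℝ) :
    ∑ x ∈ Y, |h x| ^ 3 ≤ Real.sqrt (∑ x ∈ Y, h x ^ 2) * ∑ x ∈ Y, h x ^ 2 := by
  rw [mul_sum]
  refine sum_le_sum fun x hx => ?_
  have e : |h x| ^ 3 = |h x| * h x ^ 2 := by rw [← sq_abs]; ring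
  rw [e]
  exact mul_le_mul_of_nonneg_right (abs_le_sqrt_sum_sq Y h hx) (sq_nonneg _)

/-- **THE CUBIC TAYLOR LETTER IS `≤ 6C₃·√Q·Q`**: with `Q = Σ_Y h²`, `n = #Y` and nonnegative `κ₁, κ₂, κ₃, L₁, L₂, L₃`, (338)'s
`M(h) = E₃ + 3E₁E₂ + 2E₁³` (`E₁ = κ₁Σ|h|L₁`, `E₂ = κ₁²nΣh²L₂ + κ₂Σh²`, `E₃ = κ₁³n²Σ|h|³L₃ + 3κ₂Σh²·κ₁Σ|h|L₁ + κ₃Σ|h|³`) is at most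
`[(κ₁³n²L₃ + 3κ₂κ₁√nL₁ + κ₃) + 3κ₁√nL₁(κ₁²nL₂ + κ₂) + 2(κ₁√nL₁)³]·√Q·Q`. [folklore] -/
theorem cubic_constant_le (Y : Finset ι) (h : ι → ℝ) {κ₁ κ₂ κ₃ L₁ L₂ L₃ : ℝ} (hκ₁ : 0 ≤ κ₁) (hκ₂ : 0 ≤ κ₂) (hκ₃ : 0 ≤ κ₃)
    (hL₁ : 0 ≤ L₁) (hL₂ : 0 ≤ L₂) (hL₃ : 0 ≤ L₃) :
    ((κ₁ ^ 3 * (Y.card : ℝ) ^ 2 * (∑ x ∈ Y, |h x| ^ 3) * L₃ + 3 * (κ₂ * (∑ x ∈ Y, h x ^ 2)) * (κ₁ * (∑ x ∈ Y, |h x|) * L₁) + κ₃ * (∑ x ∈ Y, |h x| ^ 3)) +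
          3 * (κ₁ * (∑ x ∈ Y, |h x|) * L₁) * (κ₁ ^ 2 * Y.card * (∑ x ∈ Y, h x ^ 2) * L₂ + κ₂ * (∑ x ∈ Y, h x ^ 2)) + 2 * (κ₁ * (∑ x ∈ Y, |h x|) * L₁) ^ 3) ≤
      ((κ₁ ^ 3 * (Y.card : ℝ) ^ 2 * L₃ + 3 * κ₂ * (κ₁ * Real.sqrt Y.card * L₁) + κ₃) +
          3 * (κ₁ * Real.sqrt Y.card * L₁) * (κ₁ ^ 2 * Y.card * L₂ + κ₂) + 2 * (κ₁ * Real.sqrt Y.card * L₁) ^ 3) * (Real.sqrt (∑ x ∈ Y, h x ^ 2) * (∑ x ∈ Y, h x ^ 2)) := by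
  have hQ0 : 0 ≤ (∑ x ∈ Y, h x ^ 2) := sum_nonneg fun x _ => sq_nonneg (h x)
  have hq0 : 0 ≤ Real.sqrt (∑ x ∈ Y, h x ^ 2) := Real.sqrt_nonneg _
  have hn0 : 0 ≤ Real.sqrt Y.card := Real.sqrt_nonneg _
  have hA := sum_abs_le_sqrt_card_mul_sqrt Y h
  have hC := sum_abs_cube_le Y h
  have hsq : Real.sqrt (∑ x ∈ Y, h x ^ 2) ^ 2 = (∑ x ∈ Y, h x ^ 2) := Real.sq_sqrt hQ0
  calc ((κ₁ ^ 3 * (Y.card : ℝ) ^ 2 * (∑ x ∈ Y, |h x| ^ 3) * L₃ + 3 * (κ₂ * (∑ x ∈ Y, h x ^ 2)) * (κ₁ * (∑ x ∈ Y, |h x|) * L₁) + κ₃ * (∑ x ∈ Y, |h x| ^ 3)) +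
          3 * (κ₁ * (∑ x ∈ Y, |h x|) * L₁) * (κ₁ ^ 2 * Y.card * (∑ x ∈ Y, h x ^ 2) * L₂ + κ₂ * (∑ x ∈ Y, h x ^ 2)) + 2 * (κ₁ * (∑ x ∈ Y, |h x|) * L₁) ^ 3)
      ≤ ((κ₁ ^ 3 * (Y.card : ℝ) ^ 2 * (Real.sqrt (∑ x ∈ Y, h x ^ 2) * (∑ x ∈ Y, h x ^ 2)) * L₃ +
            3 * (κ₂ * (∑ x ∈ Y, h x ^ 2)) * (κ₁ * (Real.sqrt Y.card * Real.sqrt (∑ x ∈ Y, h x ^ 2)) * L₁) + κ₃ * (Real.sqrt (∑ x ∈ Y, h x ^ 2) * (∑ x ∈ Y, h x ^ 2))) +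
          3 * (κ₁ * (Real.sqrt Y.card * Real.sqrt (∑ x ∈ Y, h x ^ 2)) * L₁) * (κ₁ ^ 2 * Y.card * (∑ x ∈ Y, h x ^ 2) * L₂ + κ₂ * (∑ x ∈ Y, h x ^ 2)) +
          2 * (κ₁ * (Real.sqrt Y.card * Real.sqrt (∑ x ∈ Y, h x ^ 2)) * L₁) ^ 3) := by
        gcongr
    _ = ((κ₁ ^ 3 * (Y.card : ℝ) ^ 2 * L₃ + 3 * κ₂ * (κ₁ * Real.sqrt Y.card * L₁) + κ₃) +
          3 * (κ₁ * Real.sqrt Y.card * L₁) * (κ₁ ^ 2 * Y.card * L₂ + κ₂) + 2 * (κ₁ * Real.sqrt Y.card * L₁) ^ 3) * (Real.sqrt (∑ x ∈ Y, h x ^ 2) * (∑ x ∈ Y, h x ^ 2)) := by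
        linear_combination (2 * κ₁ ^ 3 * Real.sqrt (Y.card : ℝ) ^ 3 * L₁ ^ 3 * Real.sqrt (∑ x ∈ Y, h x ^ 2)) * hsq

end CS

/-! ## §2. Pure real: the residual factor's two letters from the cubic letter; the factorisation -/

/-- **The residual factor's letters from the cubic letter**: `0 ≤ C₃`, `0 ≤ H`, `0 ≤ Q ≤ H²`, `|r| ≤ C₃·√Q·Q` ⟹ `|r| ≤ C₃HQ`,
`|r| ≤ C₃H³`, `e^r ≤ e^{C₃H·Q}`, and `C₃H³ ≤ 1 → |e^r − 1| ≤ 2C₃H³`. [folklore] -/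
theorem exp_letters_of_cubic {r C₃ H Q : ℝ} (hC : 0 ≤ C₃) (hH : 0 ≤ H) (hQ : 0 ≤ Q) (hball : Q ≤ H ^ 2)
    (hr : |r| ≤ C₃ * Real.sqrt Q * Q) :
    |r| ≤ C₃ * H * Q ∧ |r| ≤ C₃ * H ^ 3 ∧ Real.exp r ≤ Real.exp (C₃ * H * Q) ∧ (C₃ * H ^ 3 ≤ 1 → |Real.exp r - 1| ≤ 2 * (C₃ * H ^ 3)) := by
  have hsq : Real.sqrt Q ≤ H := by rw [← Real.sqrt_sq hH]; exact Real.sqrt_le_sqrt hball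
  have h1 : |r| ≤ C₃ * H * Q := hr.trans (mul_le_mul_of_nonneg_right (mul_le_mul_of_nonneg_left hsq hC) hQ)
  have h2 : |r| ≤ C₃ * H ^ 3 := h1.trans (by
    have := mul_le_mul_of_nonneg_left hball (mul_nonneg hC hH)
    calc C₃ * H * Q ≤ C₃ * H * H ^ 2 := this
      _ = C₃ * H ^ 3 := by ring)
  refine ⟨h1, h2, Real.exp_le_exp.2 ((le_abs_self r).trans h1), fun h3 => ?_⟩
  have := Real.abs_exp_sub_one_le (x := r) (h2.trans h3)
  linarith

/-- **Factorisation**: `Z₀, Z₁ > 0` ⟹ `Z₁ = Z₀·e^{ℓ + q∕2}·e^{log Z₁ − log Z₀ − ℓ − q∕2}`. [folklore] -/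
theorem factorisation_of_logs {Z₀ Z₁ : ℝ} (h0 : 0 < Z₀) (h1 : 0 < Z₁) (ℓ q : ℝ) :
    Z₁ = Z₀ * Real.exp (ℓ + q / 2) * Real.exp (Real.log Z₁ - Real.log Z₀ - ℓ - q / 2) := by
  rw [mul_assoc, ← Real.exp_add, show ℓ + q / 2 + (Real.log Z₁ - Real.log Z₀ - ℓ - q / 2) = Real.log Z₁ - Real.log Z₀ by ring,
    Real.exp_sub, Real.exp_log h1, Real.exp_log h0, mul_div_cancel₀ _ h0.ne']

/-! ## §3. THE END on the line -/

section Main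

variable {ι : Type} [Fintype ι] [DecidableEq ι]
variable {Γ : Matrix ι ι ℝ} {γop : ℝ} {w w' w'' w₃ : ι → ℝ → ℝ} {κ₀ κ₁ κ₂ κ₃ τ δ θ : ℝ}

/-- **THE CUBIC LETTER OF THE TAYLOR REMAINDER ON THE LINE, IN (384)'s FORM**: under (338)'s hypotheses and `0 ≤ L₁, L₂, L₃`,
`|log Z(ψ₀+h) − log Z(ψ₀) − (log Z)′(0) − ½(log Z)″(0)| ≤ C₃·√Q(h)·Q(h)`, `Q(h) = Σ_Y h²`, with the explicit `C₃` of the header. [folklore] -/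
theorem cubic_letter_line (hΓ : Γ.PosSemidef) (hΓop : (γop • (1 : Matrix ι ι ℝ) - Γ).PosSemidef) (Y : Finset ι)
    (hw' : ∀ x t, HasDerivAt (w x) (w' x t) t) (hw'' : ∀ x t, HasDerivAt (w' x) (w'' x t) t) (hw₃ : ∀ x t, HasDerivAt (w'' x) (w₃ x t) t)
    (hw₃m : ∀ x, Measurable (w₃ x)) (hκ₀ : 0 ≤ κ₀) (hκ₁ : 0 ≤ κ₁) (hκ₂ : 0 ≤ κ₂) (hκ₃ : 0 ≤ κ₃) (hτ : 0 < τ) (hδ : 0 < δ) (hθ0 : 0 ≤ θ)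
    (hθ1 : θ < 1) (hκθ : (2 * κ₀ * (1 + τ) + 4 * δ) * γop ≤ θ) (hstab : ∀ x, ∀ u : ℝ, -(κ₀ * u ^ 2) ≤ w x u)
    (hw'b : ∀ x u, |w' x u| ≤ κ₁ * |u|) (hw''b : ∀ x u, |w'' x u| ≤ κ₂) (hw₃b : ∀ x u, |w₃ x u| ≤ κ₃) (ψ₀ h : ι → ℝ)
    {L₁ L₂ L₃ : ℝ}
    (hI1 : ∀ t ∈ Set.Icc (0 : ℝ) 1, ∀ x ∈ Y, Integrable (fun ω : EuclideanSpace ℝ ι => exp (-(∑ x ∈ Y, w x (ω x + (ψ₀ x + t * h x)))) * |(ω x + (ψ₀ x + t * h x))|) (multivariateGaussian 0 Γ))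
    (hL1 : ∀ t ∈ Set.Icc (0 : ℝ) 1, ∀ x ∈ Y, ∫ ω : EuclideanSpace ℝ ι, exp (-(∑ x ∈ Y, w x (ω x + (ψ₀ x + t * h x)))) * |(ω x + (ψ₀ x + t * h x))| ∂(multivariateGaussian 0 Γ) ≤
      (∫ ω : EuclideanSpace ℝ ι, exp (-(∑ x ∈ Y, w x (ω x + (ψ₀ x + t * h x)))) ∂(multivariateGaussian 0 Γ)) * L₁)
    (hI2 : ∀ t ∈ Set.Icc (0 : ℝ) 1, ∀ x ∈ Y, Integrable (fun ω : EuclideanSpace ℝ ι => exp (-(∑ x ∈ Y, w x (ω x + (ψ₀ x + t * h x)))) * (ω x + (ψ₀ x + t * h x)) ^ 2) (multivariateGaussian 0 Γ))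
    (hL2 : ∀ t ∈ Set.Icc (0 : ℝ) 1, ∀ x ∈ Y, ∫ ω : EuclideanSpace ℝ ι, exp (-(∑ x ∈ Y, w x (ω x + (ψ₀ x + t * h x)))) * (ω x + (ψ₀ x + t * h x)) ^ 2 ∂(multivariateGaussian 0 Γ) ≤
      (∫ ω : EuclideanSpace ℝ ι, exp (-(∑ x ∈ Y, w x (ω x + (ψ₀ x + t * h x)))) ∂(multivariateGaussian 0 Γ)) * L₂)
    (hI3 : ∀ t ∈ Set.Icc (0 : ℝ) 1, ∀ x ∈ Y, Integrable (fun ω : EuclideanSpace ℝ ι => exp (-(∑ x ∈ Y, w x (ω x + (ψ₀ x + t * h x)))) * |(ω x + (ψ₀ x + t * h x))| ^ 3) (multivariateGaussian 0 Γ))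
    (hL3 : ∀ t ∈ Set.Icc (0 : ℝ) 1, ∀ x ∈ Y, ∫ ω : EuclideanSpace ℝ ι, exp (-(∑ x ∈ Y, w x (ω x + (ψ₀ x + t * h x)))) * |(ω x + (ψ₀ x + t * h x))| ^ 3 ∂(multivariateGaussian 0 Γ) ≤
      (∫ ω : EuclideanSpace ℝ ι, exp (-(∑ x ∈ Y, w x (ω x + (ψ₀ x + t * h x)))) ∂(multivariateGaussian 0 Γ)) * L₃)
    (hL₁ : 0 ≤ L₁) (hL₂ : 0 ≤ L₂) (hL₃ : 0 ≤ L₃) :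
    |Real.log (∫ ω : EuclideanSpace ℝ ι, exp (-(∑ x ∈ Y, w x (ω x + (ψ₀ x + h x)))) ∂(multivariateGaussian 0 Γ)) -
          Real.log (∫ ω : EuclideanSpace ℝ ι, exp (-(∑ x ∈ Y, w x (ω x + ψ₀ x))) ∂(multivariateGaussian 0 Γ)) -
        (∫ ω : EuclideanSpace ℝ ι, exp (-(∑ x ∈ Y, w x (ω x + ψ₀ x))) * -(∑ x ∈ Y, w' x (ω x + ψ₀ x) * h x) ∂(multivariateGaussian 0 Γ)) /
          (∫ ω : EuclideanSpace ℝ ι, exp (-(∑ x ∈ Y, w x (ω x + ψ₀ x))) ∂(multivariateGaussian 0 Γ)) -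
        ((∫ ω : EuclideanSpace ℝ ι, exp (-(∑ x ∈ Y, w x (ω x + ψ₀ x))) * ((∑ x ∈ Y, w' x (ω x + ψ₀ x) * h x) * (∑ x ∈ Y, w' x (ω x + ψ₀ x) * h x) - (∑ x ∈ Y, w'' x (ω x + ψ₀ x) * h x ^ 2)) ∂(multivariateGaussian 0 Γ)) *
            (∫ ω : EuclideanSpace ℝ ι, exp (-(∑ x ∈ Y, w x (ω x + ψ₀ x))) ∂(multivariateGaussian 0 Γ)) -
          (∫ ω : EuclideanSpace ℝ ι, exp (-(∑ x ∈ Y, w x (ω x + ψ₀ x))) * -(∑ x ∈ Y, w' x (ω x + ψ₀ x) * h x) ∂(multivariateGaussian 0 Γ)) *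
            (∫ ω : EuclideanSpace ℝ ι, exp (-(∑ x ∈ Y, w x (ω x + ψ₀ x))) * -(∑ x ∈ Y, w' x (ω x + ψ₀ x) * h x) ∂(multivariateGaussian 0 Γ))) /
          (∫ ω : EuclideanSpace ℝ ι, exp (-(∑ x ∈ Y, w x (ω x + ψ₀ x))) ∂(multivariateGaussian 0 Γ)) ^ 2 / 2| ≤
      ((κ₁ ^ 3 * (Y.card : ℝ) ^ 2 * L₃ + 3 * κ₂ * (κ₁ * Real.sqrt Y.card * L₁) + κ₃) +
          3 * (κ₁ * Real.sqrt Y.card * L₁) * (κ₁ ^ 2 * Y.card * L₂ + κ₂) + 2 * (κ₁ * Real.sqrt Y.card * L₁) ^ 3) / 6 * Real.sqrt (∑ x ∈ Y, h x ^ 2) * (∑ x ∈ Y, h x ^ 2) := by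
  have hT := (cubic_taylor_line hΓ hΓop Y hw' hw'' hw₃ hw₃m hκ₀ hκ₁ hκ₂ hκ₃ hτ hδ hθ0 hθ1 hκθ hstab hw'b hw''b hw₃b ψ₀ h
    hI1 hL1 hI2 hL2 hI3 hL3).1
  have hM := cubic_constant_le Y h hκ₁ hκ₂ hκ₃ hL₁ hL₂ hL₃
  refine hT.trans ?_
  rw [show ∀ a b c : ℝ, a / 6 * b * c = a * (b * c) / 6 from fun a b c => by ring]
  exact div_le_div_of_nonneg_right hM (by norm_num)

/-- **THE POST-EXTRACTION FORMAT ON THE LINE.**  Under (338)'s hypotheses, `0 ≤ L₁, L₂, L₃`, and the ball `Σ_Y h² ≤ H²` (`0 ≤ H`):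
with `Z(ψ) = ∫e^{−Σ_Y w(ω+ψ)}dN(0,Γ)`, `ℓ = (log Z)′(0)`, `q = (log Z)″(0)` along `ψ₀ + t·h` and the Taylor remainder
`r = log Z(ψ₀+h) − log Z(ψ₀) − ℓ − q∕2`:  (F) `Z(ψ₀+h) = Z(ψ₀)·e^{ℓ + q∕2}·e^{r}`;  (L1) `e^{r} ≤ e^{C₃H·Σ_Y h²}`;  (S) `C₃H³ ≤ 1 →
|e^{r} − 1| ≤ 2C₃H³` — the residual factor carries (290)'s two primary letters with RATE `C₃H` PROPORTIONAL TO THE RADIUS. [folklore] -/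
theorem extraction_format_line (hΓ : Γ.PosSemidef) (hΓop : (γop • (1 : Matrix ι ι ℝ) - Γ).PosSemidef) (Y : Finset ι)
    (hw' : ∀ x t, HasDerivAt (w x) (w' x t) t) (hw'' : ∀ x t, HasDerivAt (w' x) (w'' x t) t) (hw₃ : ∀ x t, HasDerivAt (w'' x) (w₃ x t) t)
    (hw₃m : ∀ x, Measurable (w₃ x)) (hκ₀ : 0 ≤ κ₀) (hκ₁ : 0 ≤ κ₁) (hκ₂ : 0 ≤ κ₂) (hκ₃ : 0 ≤ κ₃) (hτ : 0 < τ) (hδ : 0 < δ) (hθ0 : 0 ≤ θ)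
    (hθ1 : θ < 1) (hκθ : (2 * κ₀ * (1 + τ) + 4 * δ) * γop ≤ θ) (hstab : ∀ x, ∀ u : ℝ, -(κ₀ * u ^ 2) ≤ w x u)
    (hw'b : ∀ x u, |w' x u| ≤ κ₁ * |u|) (hw''b : ∀ x u, |w'' x u| ≤ κ₂) (hw₃b : ∀ x u, |w₃ x u| ≤ κ₃) (ψ₀ h : ι → ℝ)
    {L₁ L₂ L₃ : ℝ}
    (hI1 : ∀ t ∈ Set.Icc (0 : ℝ) 1, ∀ x ∈ Y, Integrable (fun ω : EuclideanSpace ℝ ι => exp (-(∑ x ∈ Y, w x (ω x + (ψ₀ x + t * h x)))) * |(ω x + (ψ₀ x + t * h x))|) (multivariateGaussian 0 Γ))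
    (hL1 : ∀ t ∈ Set.Icc (0 : ℝ) 1, ∀ x ∈ Y, ∫ ω : EuclideanSpace ℝ ι, exp (-(∑ x ∈ Y, w x (ω x + (ψ₀ x + t * h x)))) * |(ω x + (ψ₀ x + t * h x))| ∂(multivariateGaussian 0 Γ) ≤
      (∫ ω : EuclideanSpace ℝ ι, exp (-(∑ x ∈ Y, w x (ω x + (ψ₀ x + t * h x)))) ∂(multivariateGaussian 0 Γ)) * L₁)
    (hI2 : ∀ t ∈ Set.Icc (0 : ℝ) 1, ∀ x ∈ Y, Integrable (fun ω : EuclideanSpace ℝ ι => exp (-(∑ x ∈ Y, w x (ω x + (ψ₀ x + t * h x)))) * (ω x + (ψ₀ x + t * h x)) ^ 2) (multivariateGaussian 0 Γ))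
    (hL2 : ∀ t ∈ Set.Icc (0 : ℝ) 1, ∀ x ∈ Y, ∫ ω : EuclideanSpace ℝ ι, exp (-(∑ x ∈ Y, w x (ω x + (ψ₀ x + t * h x)))) * (ω x + (ψ₀ x + t * h x)) ^ 2 ∂(multivariateGaussian 0 Γ) ≤
      (∫ ω : EuclideanSpace ℝ ι, exp (-(∑ x ∈ Y, w x (ω x + (ψ₀ x + t * h x)))) ∂(multivariateGaussian 0 Γ)) * L₂)
    (hI3 : ∀ t ∈ Set.Icc (0 : ℝ) 1, ∀ x ∈ Y, Integrable (fun ω : EuclideanSpace ℝ ι => exp (-(∑ x ∈ Y, w x (ω x + (ψ₀ x + t * h x)))) * |(ω x + (ψ₀ x + t * h x))| ^ 3) (multivariateGaussian 0 Γ))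
    (hL3 : ∀ t ∈ Set.Icc (0 : ℝ) 1, ∀ x ∈ Y, ∫ ω : EuclideanSpace ℝ ι, exp (-(∑ x ∈ Y, w x (ω x + (ψ₀ x + t * h x)))) * |(ω x + (ψ₀ x + t * h x))| ^ 3 ∂(multivariateGaussian 0 Γ) ≤
      (∫ ω : EuclideanSpace ℝ ι, exp (-(∑ x ∈ Y, w x (ω x + (ψ₀ x + t * h x)))) ∂(multivariateGaussian 0 Γ)) * L₃)
    (hL₁ : 0 ≤ L₁) (hL₂ : 0 ≤ L₂) (hL₃ : 0 ≤ L₃) {H : ℝ} (hH : 0 ≤ H) (hball : ∑ x ∈ Y, h x ^ 2 ≤ H ^ 2) :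
    (∫ ω : EuclideanSpace ℝ ι, exp (-(∑ x ∈ Y, w x (ω x + (ψ₀ x + h x)))) ∂(multivariateGaussian 0 Γ)) =
        (∫ ω : EuclideanSpace ℝ ι, exp (-(∑ x ∈ Y, w x (ω x + ψ₀ x))) ∂(multivariateGaussian 0 Γ)) *
          Real.exp ((∫ ω : EuclideanSpace ℝ ι, exp (-(∑ x ∈ Y, w x (ω x + ψ₀ x))) * -(∑ x ∈ Y, w' x (ω x + ψ₀ x) * h x) ∂(multivariateGaussian 0 Γ)) /
          (∫ ω : EuclideanSpace ℝ ι, exp (-(∑ x ∈ Y, w x (ω x + ψ₀ x))) ∂(multivariateGaussian 0 Γ)) + ((∫ ω : EuclideanSpace ℝ ι, exp (-(∑ x ∈ Y, w x (ω x + ψ₀ x))) * ((∑ x ∈ Y, w' x (ω x + ψ₀ x) * h x) * (∑ x ∈ Y, w' x (ω x + ψ₀ x) * h x) - (∑ x ∈ Y, w'' x (ω x + ψ₀ x) * h x ^ 2)) ∂(multivariateGaussian 0 Γ)) *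
            (∫ ω : EuclideanSpace ℝ ι, exp (-(∑ x ∈ Y, w x (ω x + ψ₀ x))) ∂(multivariateGaussian 0 Γ)) -
          (∫ ω : EuclideanSpace ℝ ι, exp (-(∑ x ∈ Y, w x (ω x + ψ₀ x))) * -(∑ x ∈ Y, w' x (ω x + ψ₀ x) * h x) ∂(multivariateGaussian 0 Γ)) *
            (∫ ω : EuclideanSpace ℝ ι, exp (-(∑ x ∈ Y, w x (ω x + ψ₀ x))) * -(∑ x ∈ Y, w' x (ω x + ψ₀ x) * h x) ∂(multivariateGaussian 0 Γ))) /
          (∫ ω : EuclideanSpace ℝ ι, exp (-(∑ x ∈ Y, w x (ω x + ψ₀ x))) ∂(multivariateGaussian 0 Γ)) ^ 2 / 2) *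
          Real.exp (Real.log (∫ ω : EuclideanSpace ℝ ι, exp (-(∑ x ∈ Y, w x (ω x + (ψ₀ x + h x)))) ∂(multivariateGaussian 0 Γ)) -
          Real.log (∫ ω : EuclideanSpace ℝ ι, exp (-(∑ x ∈ Y, w x (ω x + ψ₀ x))) ∂(multivariateGaussian 0 Γ)) -
        (∫ ω : EuclideanSpace ℝ ι, exp (-(∑ x ∈ Y, w x (ω x + ψ₀ x))) * -(∑ x ∈ Y, w' x (ω x + ψ₀ x) * h x) ∂(multivariateGaussian 0 Γ)) /
          (∫ ω : EuclideanSpace ℝ ι, exp (-(∑ x ∈ Y, w x (ω x + ψ₀ x))) ∂(multivariateGaussian 0 Γ)) -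
        ((∫ ω : EuclideanSpace ℝ ι, exp (-(∑ x ∈ Y, w x (ω x + ψ₀ x))) * ((∑ x ∈ Y, w' x (ω x + ψ₀ x) * h x) * (∑ x ∈ Y, w' x (ω x + ψ₀ x) * h x) - (∑ x ∈ Y, w'' x (ω x + ψ₀ x) * h x ^ 2)) ∂(multivariateGaussian 0 Γ)) *
            (∫ ω : EuclideanSpace ℝ ι, exp (-(∑ x ∈ Y, w x (ω x + ψ₀ x))) ∂(multivariateGaussian 0 Γ)) -
          (∫ ω : EuclideanSpace ℝ ι, exp (-(∑ x ∈ Y, w x (ω x + ψ₀ x))) * -(∑ x ∈ Y, w' x (ω x + ψ₀ x) * h x) ∂(multivariateGaussian 0 Γ)) *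
            (∫ ω : EuclideanSpace ℝ ι, exp (-(∑ x ∈ Y, w x (ω x + ψ₀ x))) * -(∑ x ∈ Y, w' x (ω x + ψ₀ x) * h x) ∂(multivariateGaussian 0 Γ))) /
          (∫ ω : EuclideanSpace ℝ ι, exp (-(∑ x ∈ Y, w x (ω x + ψ₀ x))) ∂(multivariateGaussian 0 Γ)) ^ 2 / 2) ∧
      Real.exp (Real.log (∫ ω : EuclideanSpace ℝ ι, exp (-(∑ x ∈ Y, w x (ω x + (ψ₀ x + h x)))) ∂(multivariateGaussian 0 Γ)) -
          Real.log (∫ ω : EuclideanSpace ℝ ι, exp (-(∑ x ∈ Y, w x (ω x + ψ₀ x))) ∂(multivariateGaussian 0 Γ)) -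
        (∫ ω : EuclideanSpace ℝ ι, exp (-(∑ x ∈ Y, w x (ω x + ψ₀ x))) * -(∑ x ∈ Y, w' x (ω x + ψ₀ x) * h x) ∂(multivariateGaussian 0 Γ)) /
          (∫ ω : EuclideanSpace ℝ ι, exp (-(∑ x ∈ Y, w x (ω x + ψ₀ x))) ∂(multivariateGaussian 0 Γ)) -
        ((∫ ω : EuclideanSpace ℝ ι, exp (-(∑ x ∈ Y, w x (ω x + ψ₀ x))) * ((∑ x ∈ Y, w' x (ω x + ψ₀ x) * h x) * (∑ x ∈ Y, w' x (ω x + ψ₀ x) * h x) - (∑ x ∈ Y, w'' x (ω x + ψ₀ x) * h x ^ 2)) ∂(multivariateGaussian 0 Γ)) *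
            (∫ ω : EuclideanSpace ℝ ι, exp (-(∑ x ∈ Y, w x (ω x + ψ₀ x))) ∂(multivariateGaussian 0 Γ)) -
          (∫ ω : EuclideanSpace ℝ ι, exp (-(∑ x ∈ Y, w x (ω x + ψ₀ x))) * -(∑ x ∈ Y, w' x (ω x + ψ₀ x) * h x) ∂(multivariateGaussian 0 Γ)) *
            (∫ ω : EuclideanSpace ℝ ι, exp (-(∑ x ∈ Y, w x (ω x + ψ₀ x))) * -(∑ x ∈ Y, w' x (ω x + ψ₀ x) * h x) ∂(multivariateGaussian 0 Γ))) /
          (∫ ω : EuclideanSpace ℝ ι, exp (-(∑ x ∈ Y, w x (ω x + ψ₀ x))) ∂(multivariateGaussian 0 Γ)) ^ 2 / 2) ≤ Real.exp (((κ₁ ^ 3 * (Y.card : ℝ) ^ 2 * L₃ + 3 * κ₂ * (κ₁ * Real.sqrt Y.card * L₁) + κ₃) +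
          3 * (κ₁ * Real.sqrt Y.card * L₁) * (κ₁ ^ 2 * Y.card * L₂ + κ₂) + 2 * (κ₁ * Real.sqrt Y.card * L₁) ^ 3) / 6 * H * (∑ x ∈ Y, h x ^ 2)) ∧
      (((κ₁ ^ 3 * (Y.card : ℝ) ^ 2 * L₃ + 3 * κ₂ * (κ₁ * Real.sqrt Y.card * L₁) + κ₃) +
          3 * (κ₁ * Real.sqrt Y.card * L₁) * (κ₁ ^ 2 * Y.card * L₂ + κ₂) + 2 * (κ₁ * Real.sqrt Y.card * L₁) ^ 3) / 6 * H ^ 3 ≤ 1 →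
        |Real.exp (Real.log (∫ ω : EuclideanSpace ℝ ι, exp (-(∑ x ∈ Y, w x (ω x + (ψ₀ x + h x)))) ∂(multivariateGaussian 0 Γ)) -
          Real.log (∫ ω : EuclideanSpace ℝ ι, exp (-(∑ x ∈ Y, w x (ω x + ψ₀ x))) ∂(multivariateGaussian 0 Γ)) -
        (∫ ω : EuclideanSpace ℝ ι, exp (-(∑ x ∈ Y, w x (ω x + ψ₀ x))) * -(∑ x ∈ Y, w' x (ω x + ψ₀ x) * h x) ∂(multivariateGaussian 0 Γ)) /
          (∫ ω : EuclideanSpace ℝ ι, exp (-(∑ x ∈ Y, w x (ω x + ψ₀ x))) ∂(multivariateGaussian 0 Γ)) -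
        ((∫ ω : EuclideanSpace ℝ ι, exp (-(∑ x ∈ Y, w x (ω x + ψ₀ x))) * ((∑ x ∈ Y, w' x (ω x + ψ₀ x) * h x) * (∑ x ∈ Y, w' x (ω x + ψ₀ x) * h x) - (∑ x ∈ Y, w'' x (ω x + ψ₀ x) * h x ^ 2)) ∂(multivariateGaussian 0 Γ)) *
            (∫ ω : EuclideanSpace ℝ ι, exp (-(∑ x ∈ Y, w x (ω x + ψ₀ x))) ∂(multivariateGaussian 0 Γ)) -
          (∫ ω : EuclideanSpace ℝ ι, exp (-(∑ x ∈ Y, w x (ω x + ψ₀ x))) * -(∑ x ∈ Y, w' x (ω x + ψ₀ x) * h x) ∂(multivariateGaussian 0 Γ)) *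
            (∫ ω : EuclideanSpace ℝ ι, exp (-(∑ x ∈ Y, w x (ω x + ψ₀ x))) * -(∑ x ∈ Y, w' x (ω x + ψ₀ x) * h x) ∂(multivariateGaussian 0 Γ))) /
          (∫ ω : EuclideanSpace ℝ ι, exp (-(∑ x ∈ Y, w x (ω x + ψ₀ x))) ∂(multivariateGaussian 0 Γ)) ^ 2 / 2) - 1| ≤ 2 * (((κ₁ ^ 3 * (Y.card : ℝ) ^ 2 * L₃ + 3 * κ₂ * (κ₁ * Real.sqrt Y.card * L₁) + κ₃) +
          3 * (κ₁ * Real.sqrt Y.card * L₁) * (κ₁ ^ 2 * Y.card * L₂ + κ₂) + 2 * (κ₁ * Real.sqrt Y.card * L₁) ^ 3) / 6 * H ^ 3)) := by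
  have hwm : ∀ x, Measurable (w x) := fun x => (continuous_iff_continuousAt.2 fun u => (hw' x u).continuousAt).measurable
  have hκθ₀ : 2 * κ₀ * (1 + τ) * γop ≤ θ := by
    have hγ : 0 ≤ (2 * κ₀ * (1 + τ) + 4 * δ) * γop - 2 * κ₀ * (1 + τ) * γop ∨ γop < 0 := by
      by_cases hg : 0 ≤ γop
      · left; nlinarith
      · right; exact lt_of_not_ge hg
    rcases hγ with hγ | hγ
    · linarith
    · have : 2 * κ₀ * (1 + τ) * γop ≤ 0 := mul_nonpos_of_nonneg_of_nonpos (by positivity) hγ.le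
      have hθ' : 0 ≤ θ := hθ0
      linarith
  have hZ1 := (lineZ_pos hΓ hΓop Y hwm hκ₀ hτ hθ1 hκθ₀ hstab ψ₀ h 1).2
  have hZ0 := (lineZ_pos hΓ hΓop Y hwm hκ₀ hτ hθ1 hκθ₀ hstab ψ₀ h 0).2
  simp only [one_mul] at hZ1
  simp only [zero_mul, add_zero] at hZ0
  have hr := cubic_letter_line hΓ hΓop Y hw' hw'' hw₃ hw₃m hκ₀ hκ₁ hκ₂ hκ₃ hτ hδ hθ0 hθ1 hκθ hstab hw'b hw''b hw₃b ψ₀ h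
    hI1 hL1 hI2 hL2 hI3 hL3 hL₁ hL₂ hL₃
  have hC : 0 ≤ ((κ₁ ^ 3 * (Y.card : ℝ) ^ 2 * L₃ + 3 * κ₂ * (κ₁ * Real.sqrt Y.card * L₁) + κ₃) +
          3 * (κ₁ * Real.sqrt Y.card * L₁) * (κ₁ ^ 2 * Y.card * L₂ + κ₂) + 2 * (κ₁ * Real.sqrt Y.card * L₁) ^ 3) / 6 := by positivity
  obtain ⟨-, -, hL, hS⟩ := exp_letters_of_cubic hC hH (sum_nonneg fun x _ => sq_nonneg (h x)) hball hr
  exact ⟨factorisation_of_logs hZ0 hZ1 _ _, hL, hS⟩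

end Main

/-! ## §4. Toy -/

/-- Toy (§2): the zero remainder is small (`|e^0 − 1| = 0`). -/
example : |Real.exp 0 - 1| ≤ 2 * (0 * (1 : ℝ) ^ 3) :=
  (exp_letters_of_cubic (r := 0) (C₃ := 0) (H := 1) (Q := 1) le_rfl zero_le_one zero_le_one (by norm_num) (by simp)).2.2.2 (by norm_num)

end Summit.QuantumFields.BalabanUV.T4Continuum.NE7b.SupQuadraticExtractionLine
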